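import Summits.Parity.GeneralizedHardyLittlewood.Theorems.PrimeLevelFamEdgeIdeaDeltasFloorDualCells
import HarnessLib

/-!
# Route `PrimeLevelFamEdge` — TYPED IDEA DELTAS, deck 18h: K-L21-3 — CELL BOOKKEEPING part 2 + ASSEMBLY: `cell_integral_cos`,
# `cell_coeff`, `integral_quarterRho` / `integral_quarterNu`, the fold `tsum_quarterG`, **`quarterParseval` PROVED**, hence
# **`quarterWitnessExistsQD`** and **`heightWallLowerEdge : HeightWallLowerEdge`** WITH NO HYPOTHESES (no one-sided floor
# certificate at any height `≤ (π²−4π+8)/(2π(π−2)) = 0.7393494…` on `(1,B]`, `B ≤ 3`, any window `< ½`).  Seat ls-idea-lens-21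
# g2, `Sketch_L21_DualWitness.lean` v1.6 sha16 18bf34caa2eaa694 l.1491–1859 VERBATIM up to the QD renaming (critic F b26.8
# VERIFIED: axioms standard, no sorryAx); typer ls-idea-typ-1 gen 3.
HONESTY: a no-go theorem about the cell's own one-sided certificate class, nothing about zeta zeros; no exceptional-zero
theorem (no Landau–Siegel / Siegel-zero exclusion, no Theorem 1–2 of arXiv:2211.02515, no repaired Margin232) is proved.
-/

namespace Summit.Parity.GeneralizedHardyLittlewood.Theorems.PrimeLevelFamEdgeIdeaDeltas.FloorDual

open Literature.NumberTheory.LFunctions MeasureTheory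
open scoped Real

section Bookkeeping
open Complex (I)

/-! #### The cell integrals -/

/-- `cos(c·)·fullDensity` is interval-integrable. -/
theorem intervalIntegrable_cos_mul_fullDensity (c a b : ℝ) (hab : a ≤ b) :
    IntervalIntegrable (fun x => Real.cos (c * x) * fullDensity x) volume a b := by
  rw [intervalIntegrable_iff_integrableOn_Ioc_of_le hab]
  refine Integrable.mono' (g := fun _ => (1 : ℝ)) (integrable_const _) ?_ (ae_of_all _ fun x => ?_)
  · exact ((by fun_prop : Measurable fun x => Real.cos (c * x)).mul
      measurable_fullDensity).aestronglyMeasurable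
  · rw [norm_mul, Real.norm_eq_abs, Real.norm_eq_abs, abs_of_nonneg (fullDensity_nonneg x)]
    nlinarith [abs_nonneg (Real.cos (c * x)), Real.abs_cos_le_one (c * x), fullDensity_nonneg x,
      fullDensity_le_one x]

/-- `∫_{−2}^{2} cos(cx) G(x) dx = 2∫₀¹ β cos(cβ) dβ + 2t ∫₁² cos(cβ) dβ` (PROVED). -/
theorem cell_integral_cos (c : ℝ) :
    ∫ x in (-2 : ℝ)..2, Real.cos (c * x) * fullDensity x =
      2 * (∫ β in (0 : ℝ)..1, β * Real.cos (c * β))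
        + 2 * quarterLevel * ∫ β in (1 : ℝ)..2, Real.cos (c * β) := by
  have hii := intervalIntegrable_cos_mul_fullDensity c
  -- split at 0
  rw [← intervalIntegral.integral_add_adjacent_intervals (hii (-2) 0 (by norm_num)) (hii 0 2 (by norm_num))]
  -- the negative half equals the positive half
  have hneg : ∫ x in (-2 : ℝ)..0, Real.cos (c * x) * fullDensity x
      = ∫ x in (0 : ℝ)..2, Real.cos (c * x) * fullDensity x := by
    have h := intervalIntegral.integral_comp_neg (fun x => Real.cos (c * x) * fullDensity x)
      (a := (0 : ℝ)) (b := 2)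
    simp only [neg_zero] at h
    rw [← h]
    refine intervalIntegral.integral_congr fun x hx => ?_
    rw [Set.uIcc_of_le (by norm_num : (0:ℝ) ≤ 2)] at hx
    have hx2 : |x| ≤ 2 := abs_le.mpr ⟨by linarith [hx.1], hx.2⟩
    rw [fullDensity_cell (by rwa [abs_neg]), fullDensity_cell hx2, abs_neg, mul_neg, Real.cos_neg]
  rw [hneg, ← intervalIntegral.integral_add_adjacent_intervals (hii 0 1 (by norm_num))
    (hii 1 2 (by norm_num))]
  -- on [0,1]: G = β
  have h01 : ∫ x in (0 : ℝ)..1, Real.cos (c * x) * fullDensity x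
      = ∫ β in (0 : ℝ)..1, β * Real.cos (c * β) := by
    refine intervalIntegral.integral_congr fun x hx => ?_
    rw [Set.uIcc_of_le (by norm_num : (0:ℝ) ≤ 1)] at hx
    have hx1 : |x| ≤ 1 := abs_le.mpr ⟨by linarith [hx.1], hx.2⟩
    rw [fullDensity_cell (by linarith [hx1] : |x| ≤ 2), if_pos hx1, abs_of_nonneg hx.1, mul_comm]
  -- on (1,2]: G = t
  have h12 : ∫ x in (1 : ℝ)..2, Real.cos (c * x) * fullDensity x
      = ∫ β in (1 : ℝ)..2, Real.cos (c * β) * quarterLevel := by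
    refine intervalIntegral.integral_congr_ae (ae_of_all _ fun x hx => ?_)
    rw [Set.mem_uIoc] at hx
    rcases hx with ⟨h1, h2⟩ | ⟨h1, h2⟩
    · have hx2 : |x| ≤ 2 := abs_le.mpr ⟨by linarith, h2⟩
      have hx1 : ¬ |x| ≤ 1 := by rw [abs_of_nonneg (by linarith)]; linarith
      rw [fullDensity_cell hx2, if_neg hx1]
    · linarith
  rw [h01, h12, intervalIntegral.integral_mul_const]
  ring

/-- The cell integral for an integer frequency, in the shape used by the coefficient table. -/
theorem cell_integral_int (n : ℤ) :
    ∫ x in (-2 : ℝ)..2, Real.cos (π * n * x / 2) * fullDensity x =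
      2 * (∫ β in (0 : ℝ)..1, β * Real.cos (π * n / 2 * β))
        + 2 * quarterLevel * ∫ β in (1 : ℝ)..2, Real.cos (π * n / 2 * β) := by
  have h : ∀ x : ℝ, π * n * x / 2 = π * n / 2 * x := fun x => by ring
  simp_rw [h]
  exact cell_integral_cos _

/-- For `n ≠ 0`: `1 + b cos(πn) + J_n = 4 c_{|n|}` (the coefficient table, PROVED). -/
theorem cell_coeff {n : ℤ} (hn : n ≠ 0) :
    1 + quarterAtom * Real.cos (π * n)
      + ∫ x in (-2 : ℝ)..2, Real.cos (π * n * x / 2) * fullDensity x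
      = 4 * quarterCoeff n.natAbs := by
  have hk : 1 ≤ n.natAbs := Int.natAbs_pos.mpr hn
  rw [four_mul_quarterCoeff_eq_integral n.natAbs hk, cell_integral_int]
  rcases Int.natAbs_eq n with h | h
  · -- n = |n|
    have hc : (n : ℝ) = (n.natAbs : ℝ) := by
      rw [← Int.cast_natCast (R := ℝ) n.natAbs, ← h]
    rw [hc, show π * (n.natAbs : ℝ) = (n.natAbs : ℝ) * π by ring, Real.cos_nat_mul_pi]
    ring
  · -- n = -|n|
    have hc : (n : ℝ) = -(n.natAbs : ℝ) := by
      rw [← Int.cast_natCast (R := ℝ) n.natAbs, ← Int.cast_neg, ← h]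
    have e1 : ∀ β : ℝ, Real.cos (π * (n : ℝ) / 2 * β) = Real.cos (π * (n.natAbs : ℝ) / 2 * β) := by
      intro β; rw [hc, show π * -(n.natAbs : ℝ) / 2 * β = -(π * (n.natAbs : ℝ) / 2 * β) by ring,
        Real.cos_neg]
    simp_rw [e1]
    rw [hc, show π * -(n.natAbs : ℝ) = -((n.natAbs : ℝ) * π) by ring, Real.cos_neg, Real.cos_nat_mul_pi]
    ring

/-- For `n = 0`: `1 + b + J_0 = 4`. -/
theorem cell_coeff_zero :
    1 + quarterAtom + ∫ x in (-2 : ℝ)..2, Real.cos (π * (0 : ℤ) * x / 2) * fullDensity x = 4 := by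
  rw [cell_integral_int]
  push_cast
  simp only [mul_zero, zero_div, zero_mul, Real.cos_zero, mul_one]
  rw [integral_id, intervalIntegral.integral_const]
  unfold quarterAtom
  norm_num
  ring

/-! #### Unpacking the two measures -/

/-- A continuous function is integrable against a Dirac mass. -/
theorem integrable_dirac_of_continuous {f : ℝ → ℝ} (hf : Continuous f) (a : ℝ) :
    Integrable f (Measure.dirac a) := by
  refine ⟨hf.aestronglyMeasurable, ?_⟩
  show ∫⁻ x, ‖f x‖ₑ ∂Measure.dirac a < ⊤
  rw [lintegral_dirac]
  exact enorm_lt_top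

/-- `∫ r dρ = Σ_{k≥2} c_k (r(k/4) + r(−k/4))` (PROVED). -/
theorem integral_quarterRho {f : ℝ → ℝ} (hfc : Continuous f) (hf : Integrable f quarterRho) :
    ∫ u, f u ∂quarterRho =
      ∑' k : ℕ, quarterCoeff (k + 2) * (f ((k + 2 : ℝ) / 4) + f (-((k + 2 : ℝ) / 4))) := by
  unfold quarterRho at hf ⊢
  rw [MeasureTheory.integral_sum_measure hf]
  refine tsum_congr fun k => ?_
  rw [integral_smul_measure, integral_add_measure (integrable_dirac_of_continuous hfc _)
    (integrable_dirac_of_continuous hfc _), integral_dirac, integral_dirac,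
    ENNReal.toReal_ofReal (quarterWitnessNonneg (k + 2) (by omega)), smul_eq_mul]

/-- `∫ R dν = ∫ quarterDensity·R + Σ_{j≠0} R(4j) + b Σ_j R(4j+2)` (PROVED). -/
theorem integral_quarterNu {R : ℝ → ℝ} (hν : Integrable R quarterNu) :
    ∫ α, R α ∂quarterNu =
      (∫ α, quarterDensity α * R α) + (∑' j : ℤ, if j = 0 then (0 : ℝ) else R (4 * j))
        + quarterAtom * ∑' j : ℤ, R (4 * j + 2) := by
  have hA : Integrable R (volume.withDensity fun α => ENNReal.ofReal (quarterDensity α)) :=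
    hν.mono_measure (by unfold quarterNu; exact Measure.le_add_right le_rfl)
  have hB : Integrable R (Measure.sum fun j : ℤ =>
      if j = 0 then (0 : Measure ℝ) else Measure.dirac (4 * (j : ℝ))) :=
    hν.mono_measure (by unfold quarterNu; exact Measure.le_add_left (Measure.le_add_right le_rfl))
  have hC : Integrable R (Measure.sum fun j : ℤ =>
      (ENNReal.ofReal quarterAtom) • Measure.dirac (4 * (j : ℝ) + 2)) :=
    hν.mono_measure (by unfold quarterNu; exact Measure.le_add_left (Measure.le_add_left le_rfl))
  unfold quarterNu
  rw [integral_add_measure hA (hB.add_measure hC), integral_add_measure hB hC]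
  have h1 : ∫ α, R α ∂(volume.withDensity fun α => ENNReal.ofReal (quarterDensity α))
      = ∫ α, quarterDensity α * R α := by
    rw [integral_withDensity_eq_integral_toReal_smul (f := fun α => ENNReal.ofReal (quarterDensity α))
      (ENNReal.measurable_ofReal.comp measurable_quarterDensity)
      (ae_of_all _ fun x => ENNReal.ofReal_lt_top)]
    refine integral_congr_ae (ae_of_all _ fun x => ?_)
    simp only
    rw [ENNReal.toReal_ofReal (quarterDensity_nonneg x), smul_eq_mul]
  have h2 : ∫ α, R α ∂(Measure.sum fun j : ℤ =>
      if j = 0 then (0 : Measure ℝ) else Measure.dirac (4 * (j : ℝ)))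
      = ∑' j : ℤ, if j = 0 then (0 : ℝ) else R (4 * j) := by
    rw [MeasureTheory.integral_sum_measure hB]
    refine tsum_congr fun j => ?_
    by_cases hj : j = 0
    · subst hj; simp
    · rw [if_neg hj, if_neg hj, integral_dirac]
  have h3 : ∫ α, R α ∂(Measure.sum fun j : ℤ =>
      (ENNReal.ofReal quarterAtom) • Measure.dirac (4 * (j : ℝ) + 2))
      = quarterAtom * ∑' j : ℤ, R (4 * j + 2) := by
    rw [MeasureTheory.integral_sum_measure hC, ← tsum_mul_left]
    refine tsum_congr fun j => ?_
    rw [integral_smul_measure, integral_dirac, ENNReal.toReal_ofReal quarterAtom_nonneg, smul_eq_mul]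
  rw [h1, h2, h3]
  ring

/-! #### The coefficient function on `ℤ` and the assembly -/

/-- `g_n`: `1` at `n = 0`, `c_{|n|}` otherwise (so `g_{±1} = 0`). -/
noncomputable def quarterG (n : ℤ) : ℝ := if n = 0 then 1 else quarterCoeff n.natAbs

/-- `|c_k| ≤ 1` for `k ≥ 1`. -/
theorem abs_quarterCoeff_le_one (k : ℕ) (hk : 1 ≤ k) : |quarterCoeff k| ≤ 1 := by
  rcases Nat.lt_or_ge k 2 with h | h
  · have : k = 1 := by omega
    subst this; rw [quarterCoeff_one, abs_zero]; exact zero_le_one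
  · rw [abs_of_nonneg (quarterWitnessNonneg k h)]; exact quarterCoeff_le_one k h

/-- `|quarterG n| ≤ 1`. -/
theorem abs_quarterG_le_one (n : ℤ) : |quarterG n| ≤ 1 := by
  unfold quarterG; split_ifs with h
  · simp
  · exact abs_quarterCoeff_le_one _ (Int.natAbs_pos.mpr h)

/-- Pairing of the `±k` terms of the lattice sum. -/
theorem quarterG_pair (k : ℕ) (r : ℝ → ℝ) :
    quarterG ((k + 1 + 1 : ℕ) : ℤ) * r ((((k + 1 + 1 : ℕ) : ℤ) : ℝ) / 4)
      + quarterG (-((k + 1 + 1 : ℕ) : ℤ)) * r (((-((k + 1 + 1 : ℕ) : ℤ) : ℤ) : ℝ) / 4)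
      = quarterCoeff (k + 2) * (r ((k + 2 : ℝ) / 4) + r (-((k + 2 : ℝ) / 4))) := by
  have h1 : quarterG ((k + 1 + 1 : ℕ) : ℤ) = quarterCoeff (k + 2) := by
    unfold quarterG; rw [if_neg (by omega), Int.natAbs_natCast]
  have h2 : quarterG (-((k + 1 + 1 : ℕ) : ℤ)) = quarterCoeff (k + 2) := by
    unfold quarterG; rw [if_neg (by omega), Int.natAbs_neg, Int.natAbs_natCast]
  have h3 : ((((k + 1 + 1 : ℕ) : ℤ) : ℝ)) = (k + 2 : ℝ) := by push_cast; ring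
  have h4 : (((-((k + 1 + 1 : ℕ) : ℤ)) : ℤ) : ℝ) = -(k + 2 : ℝ) := by push_cast; ring
  rw [h1, h2, h3, h4, neg_div]; ring

/-- The `k = 1` terms vanish (`c₁ = 0`). -/
theorem quarterG_one (r : ℝ → ℝ) :
    quarterG ((0 + 1 : ℕ) : ℤ) * r ((((0 + 1 : ℕ) : ℤ) : ℝ) / 4)
      + quarterG (-((0 + 1 : ℕ) : ℤ)) * r (((-((0 + 1 : ℕ) : ℤ) : ℤ) : ℝ) / 4) = 0 := by
  have h1 : quarterG ((0 + 1 : ℕ) : ℤ) = 0 := by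
    unfold quarterG; rw [if_neg (by omega)]; exact quarterCoeff_one
  have h2 : quarterG (-((0 + 1 : ℕ) : ℤ)) = 0 := by
    unfold quarterG; rw [if_neg (by omega)]; exact quarterCoeff_one
  rw [h1, h2]; ring

/-- Folding the `ℤ`-series onto `k ≥ 2` (PROVED): `Σ_{n∈ℤ} g_n r(n/4) = r(0) + Σ_{k≥2} c_k (r(k/4)+r(−k/4))`. -/
theorem tsum_quarterG {r : ℝ → ℝ} (hdecay : ∃ C : ℝ, ∀ u : ℝ, |r u| ≤ C / (1 + u ^ 2)) :
    ∑' n : ℤ, quarterG n * r ((n : ℝ) / 4) =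
      r 0 + ∑' k : ℕ, quarterCoeff (k + 2) * (r ((k + 2 : ℝ) / 4) + r (-((k + 2 : ℝ) / 4))) := by
  have hs := summable_sample_quarter hdecay
  have he : Summable fun n : ℤ => quarterG n * r ((n : ℝ) / 4) := by
    refine Summable.of_norm_bounded hs fun n => ?_
    rw [Real.norm_eq_abs, abs_mul]
    exact mul_le_of_le_one_left (abs_nonneg _) (abs_quarterG_le_one n)
  have h1 := tsum_nat_add_neg he
  have h2 : Summable fun n : ℕ =>
      quarterG n * r (((n : ℤ) : ℝ) / 4) + quarterG (-(n : ℤ)) * r (((-(n : ℤ) : ℤ) : ℝ) / 4) :=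
    (he.hasSum.nat_add_neg).summable
  rw [h2.tsum_eq_zero_add, ((summable_nat_add_iff 1).mpr h2).tsum_eq_zero_add] at h1
  simp only [quarterG_pair, quarterG_one, zero_add] at h1
  have h0 : quarterG ((0 : ℕ) : ℤ) * r ((((0 : ℕ) : ℤ) : ℝ) / 4)
      + quarterG (-((0 : ℕ) : ℤ)) * r (((-((0 : ℕ) : ℤ) : ℤ) : ℝ) / 4) = 2 * r 0 := by
    unfold quarterG; simp; ring
  have h0' : quarterG 0 * r (((0 : ℤ) : ℝ) / 4) = r 0 := by unfold quarterG; simp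
  rw [h0, h0'] at h1
  linarith

/-- The termwise identity `¼ r(n/4) (1 + b cos πn + J_n) = g_n r(n/4)`. -/
theorem quarter_term (r : ℝ → ℝ) (n : ℤ) :
    1 / 4 * r ((n : ℝ) / 4) + quarterAtom * (1 / 4 * r ((n : ℝ) / 4) * Real.cos (π * n))
      + 1 / 4 * r ((n : ℝ) / 4) * ∫ x in (-2 : ℝ)..2, Real.cos (π * n * x / 2) * fullDensity x
      = quarterG n * r ((n : ℝ) / 4) := by
  by_cases hn : n = 0
  · subst hn
    have h := cell_coeff_zero
    unfold quarterG
    rw [if_pos rfl, show Real.cos (π * ((0 : ℤ) : ℝ)) = 1 by simp]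
    linear_combination (1 / 4 * r (((0 : ℤ) : ℝ) / 4)) * h
  · have h := cell_coeff hn
    unfold quarterG
    rw [if_neg hn]
    linear_combination (1 / 4 * r ((n : ℝ) / 4)) * h

/-- Bound on one cell integral. -/
theorem abs_cellIntegral_le (n : ℤ) :
    |∫ x in (-2 : ℝ)..2, Real.cos (π * n * x / 2) * fullDensity x| ≤ 4 := by
  have h := intervalIntegral.norm_integral_le_of_norm_le_const (a := (-2 : ℝ)) (b := 2) (C := 1)
    (f := fun x => Real.cos (π * n * x / 2) * fullDensity x) (fun x _ => by
      rw [norm_mul, Real.norm_eq_abs, Real.norm_eq_abs, abs_of_nonneg (fullDensity_nonneg x)]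
      nlinarith [abs_nonneg (Real.cos (π * n * x / 2)), Real.abs_cos_le_one (π * n * x / 2),
        fullDensity_nonneg x, fullDensity_le_one x])
  rw [Real.norm_eq_abs] at h
  refine le_trans h ?_
  norm_num

/-- **`QuarterParseval` (PROVED, v1.6)**: the cell bookkeeping is a theorem — Poisson summation on
`¼ℤ` fibrewise over the cells `(4j−2, 4j+2]`, two dominated interchanges, the coefficient table
`four_mul_quarterCoeff_eq_integral`, and the fold `ℤ → {k ≥ 2}` (using `c₁ = 0`). -/
theorem quarterParseval : QuarterParseval := by
  intro r heven hcont hint hdecay htdecay hρ hν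
  have hRc : Continuous (BGMM2023.cosTransform r) := continuous_cosTransform hint
  have hRi : Integrable (BGMM2023.cosTransform r) := integrable_of_quadratic_decay hRc htdecay
  have hs := summable_sample_quarter hdecay
  obtain ⟨C', hC'⟩ := id htdecay
  have hC0 : 0 ≤ C' := by
    have := hC' 0
    simp only [ne_eq, OfNat.ofNat_ne_zero, not_false_eq_true, zero_pow, add_zero, div_one] at this
    exact le_trans (abs_nonneg _) this
  rw [integral_quarterRho hcont hρ, integral_quarterNu hν]
  -- (A) the unit atoms on 4ℤ
  have hR4 : Summable fun j : ℤ => BGMM2023.cosTransform r (4 * j) := by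
    refine Summable.of_norm_bounded (summable_const_div_one_add_sq_int C') fun j => ?_
    rw [Real.norm_eq_abs]
    refine le_trans (hC' _) ?_
    exact div_le_div_of_nonneg_left hC0 (by positivity) (by nlinarith [sq_nonneg (j : ℝ)])
  have hA : BGMM2023.cosTransform r 0
      + ∑' j : ℤ, (if j = 0 then (0 : ℝ) else BGMM2023.cosTransform r (4 * j))
      = ∑' n : ℤ, 1 / 4 * r ((n : ℝ) / 4) := by
    have h1 := hR4.tsum_eq_add_tsum_ite 0
    have h2 := quarter_poisson_real heven hcont hint hdecay htdecay 0
    simp only [zero_add, mul_zero, zero_div, Real.cos_zero, mul_one] at h2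
    simp only [Int.cast_zero, mul_zero] at h1
    rw [← h2, h1]
  -- (B) the b-atoms on 4ℤ+2
  have hB : ∑' j : ℤ, BGMM2023.cosTransform r (4 * j + 2)
      = ∑' n : ℤ, 1 / 4 * r ((n : ℝ) / 4) * Real.cos (π * n) := by
    have h := quarter_poisson_real heven hcont hint hdecay htdecay 2
    have e : ∀ j : ℤ, (2 : ℝ) + 4 * j = 4 * j + 2 := fun j => by ring
    have e2 : ∀ n : ℤ, π * (n : ℝ) * 2 / 2 = π * n := fun n => by ring
    simp_rw [e, e2] at h
    exact h
  -- (C) the density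
  have hC : 2 * (∫ α in (0 : ℝ)..1, α * BGMM2023.cosTransform r α)
      + ∫ α, quarterDensity α * BGMM2023.cosTransform r α
      = ∑' n : ℤ, 1 / 4 * r ((n : ℝ) / 4) *
          ∫ x in (-2 : ℝ)..2, Real.cos (π * n * x / 2) * fullDensity x := by
    rw [← integral_fullDensity_mul heven hcont hint hdecay htdecay]
    have hqdR : Integrable fun α => quarterDensity α * BGMM2023.cosTransform r α := by
      refine Integrable.mono' hRi.norm
        (measurable_quarterDensity.mul hRc.measurable).aestronglyMeasurable (ae_of_all _ fun α => ?_)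
      rw [norm_mul, Real.norm_eq_abs, abs_of_nonneg (quarterDensity_nonneg α)]
      exact mul_le_of_le_one_left (norm_nonneg _) (quarterDensity_le_one α)
    have hind : (fun α => Set.indicator (Set.Icc (-1 : ℝ) 1) (fun x => |x|) α * BGMM2023.cosTransform r α)
        = Set.indicator (Set.Icc (-1 : ℝ) 1) (fun x => |x| * BGMM2023.cosTransform r x) := by
      ext α; exact (Set.indicator_mul_left _ _ _).symm
    have hindI : Integrable fun α =>
        Set.indicator (Set.Icc (-1 : ℝ) 1) (fun x => |x|) α * BGMM2023.cosTransform r α := by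
      rw [hind, integrable_indicator_iff measurableSet_Icc]
      exact (continuous_abs.mul hRc).integrableOn_Icc
    have hG : ∫ α, fullDensity α * BGMM2023.cosTransform r α
        = (∫ α, quarterDensity α * BGMM2023.cosTransform r α)
          + ∫ α, Set.indicator (Set.Icc (-1 : ℝ) 1) (fun x => |x|) α * BGMM2023.cosTransform r α := by
      rw [← integral_add hqdR hindI]
      refine integral_congr_ae (ae_of_all _ fun α => ?_)
      simp only
      rw [fullDensity_eq_quarterDensity_add, add_mul]
    have hI : ∫ α, Set.indicator (Set.Icc (-1 : ℝ) 1) (fun x => |x|) α * BGMM2023.cosTransform r α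
        = 2 * ∫ α in (0 : ℝ)..1, α * BGMM2023.cosTransform r α := by
      rw [hind, integral_indicator measurableSet_Icc, integral_Icc_eq_integral_Ioc,
        ← intervalIntegral.integral_of_le (by norm_num)]
      have hii : ∀ a b : ℝ, IntervalIntegrable (fun x => |x| * BGMM2023.cosTransform r x) volume a b :=
        fun a b => (continuous_abs.mul hRc).intervalIntegrable _ _
      rw [← intervalIntegral.integral_add_adjacent_intervals (hii (-1) 0) (hii 0 1)]
      have hneg : ∫ x in (-1 : ℝ)..0, |x| * BGMM2023.cosTransform r x
          = ∫ x in (0 : ℝ)..1, |x| * BGMM2023.cosTransform r x := by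
        have h := intervalIntegral.integral_comp_neg (fun x => |x| * BGMM2023.cosTransform r x)
          (a := (0 : ℝ)) (b := 1)
        simp only [neg_zero] at h
        rw [← h]
        refine intervalIntegral.integral_congr fun x _ => ?_
        simp only [abs_neg, cosTransform_neg]
      have hpos : ∫ x in (0 : ℝ)..1, |x| * BGMM2023.cosTransform r x
          = ∫ x in (0 : ℝ)..1, x * BGMM2023.cosTransform r x := by
        refine intervalIntegral.integral_congr fun x hx => ?_
        rw [Set.uIcc_of_le (by norm_num : (0:ℝ) ≤ 1)] at hx
        rw [abs_of_nonneg hx.1]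
      rw [hneg, hpos]
      ring
    rw [hG, hI]
    ring
  -- summabilities for the merge
  have hsA : Summable fun n : ℤ => 1 / 4 * r ((n : ℝ) / 4) := (hs.of_abs).mul_left (1 / 4)
  have hsB : Summable fun n : ℤ =>
      quarterAtom * (1 / 4 * r ((n : ℝ) / 4) * Real.cos (π * n)) := by
    refine Summable.of_norm_bounded ((hs.mul_left (1 / 4)).mul_left quarterAtom) fun n => ?_
    rw [Real.norm_eq_abs, abs_mul, abs_mul, abs_mul, abs_of_nonneg quarterAtom_nonneg,
      abs_of_pos (by norm_num : (0:ℝ) < 1 / 4)]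
    have := Real.abs_cos_le_one (π * n)
    have := abs_nonneg (Real.cos (π * n))
    have := abs_nonneg (r ((n : ℝ) / 4))
    have := quarterAtom_nonneg
    nlinarith [mul_le_mul_of_nonneg_left ‹|Real.cos (π * n)| ≤ 1› ‹0 ≤ |r ((n:ℝ)/4)|›]
  have hsC : Summable fun n : ℤ => 1 / 4 * r ((n : ℝ) / 4) *
      ∫ x in (-2 : ℝ)..2, Real.cos (π * n * x / 2) * fullDensity x := by
    refine Summable.of_norm_bounded hs fun n => ?_
    rw [Real.norm_eq_abs, abs_mul, abs_mul, abs_of_pos (by norm_num : (0:ℝ) < 1 / 4)]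
    have h4 := abs_cellIntegral_le n
    have := abs_nonneg (r ((n : ℝ) / 4))
    have := abs_nonneg (∫ x in (-2 : ℝ)..2, Real.cos (π * n * x / 2) * fullDensity x)
    nlinarith [mul_le_mul_of_nonneg_left h4 ‹0 ≤ |r ((n:ℝ)/4)|›]
  have hsum : (∑' n : ℤ, 1 / 4 * r ((n : ℝ) / 4))
      + quarterAtom * (∑' n : ℤ, 1 / 4 * r ((n : ℝ) / 4) * Real.cos (π * n))
      + (∑' n : ℤ, 1 / 4 * r ((n : ℝ) / 4) *
          ∫ x in (-2 : ℝ)..2, Real.cos (π * n * x / 2) * fullDensity x)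
      = ∑' n : ℤ, quarterG n * r ((n : ℝ) / 4) := by
    rw [← tsum_mul_left, ← hsA.tsum_add hsB, ← (hsA.add hsB).tsum_add hsC]
    exact tsum_congr fun n => quarter_term r n
  have hL := tsum_quarterG (r := r) hdecay
  linear_combination -hL - hsum - hA - quarterAtom * hB - hC

end Bookkeeping

/-- **The AH¼ dual witness EXISTS (PROVED — no hypotheses; quadratic-decay Parseval class of deck 18c).** -/
theorem quarterWitnessExistsQD : QuarterWitnessExistsQD := quarterWitnessExistsQD_of quarterParseval

/-- **LOWER EDGE OF THE HEIGHT WALL (PROVED — no hypotheses):** no one-sided floor certificate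
(`HeightCertificate`: even, continuous, `L¹`, quadratic decay of `r` and `r̂`, `r(0) = 1`, `r ≤ 0` off
`(−λ, λ)`, `r̂ ≥ 0` on `|α| ≥ 1`, criterion `cValue r + 2c∫₁ᴮ r̂ > 0`) exists at any height
`c ≤ t = (π² − 4π + 8)/(2π(π − 2)) = 0.7393494…` on `1 < |α| < B`, `B ≤ 3`, for any window `λ < ½`.
A statement about the METHOD class, not about zeta zeros. -/
theorem heightWallLowerEdge : HeightWallLowerEdge := heightWallLowerEdge_of_parseval quarterParseval

end Summit.Parity.GeneralizedHardyLittlewood.Theorems.PrimeLevelFamEdgeIdeaDeltas.FloorDual
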